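import Summits.CriticalPhenomena.PercolationContinuityZ3.Theorems.SahiAECornerEnvelopeExplicit

/-!
# Addenda to the lower-corner envelope API

Support file of the Sahi cell (`prim-sahi`, typer seat, generation 25; `--supports stmt-CriticalPhenomena-4575`).
Theorems only (no definitions, no named facts, no sorries).

First file of the structure theorem for densities WITH ZEROS in every dimension (the planar case is
`SahiAEPlaneZeros.lean`, generation 24); small complements to `SahiAECornerEnvelopeExplicit.lean` (generation 23):

* `ae_le_cornerEnvelope` — the lower-corner envelope `cornerEnvelope g = infₙ ess sup_{∏ (pᵢ − rₙ, pᵢ]} g` of ANY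
  measurable density `g` dominates `g` almost everywhere (Lebesgue density points of the rational superlevel sets;
  this is the half of `cornerEnvelope_ae_eq` that does not use monotonicity);
* `cornerEnvelope_mul_le_of_ne_top` — the MTP₂ inequality of the envelope of an a.e.-MTP₂ density at a pair
  `(x, y)` only needs finiteness of the envelope at `x, y, x ∧ y, x ∨ y` (the corner essential suprema are MTP₂ at
  every pair unconditionally, `cornerEssSup_mul_le`);
* bounds of the envelope from a.e. bounds on ONE corner box (`cornerEnvelope_le_of_ae_restrict_le`,
  `le_cornerEnvelope_of_ae_restrict_le`), nested corner boxes, and `eventually_lowerCorner_gt`.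

No sorries, no new axioms.
-/

noncomputable section

namespace Summit.CriticalPhenomena.PercolationContinuityZ3.Theorems.SahiAEFourFunctions

open MeasureTheory Set Filter Topology Function Metric
open scoped ENNReal NNReal

variable {ι : Type*} [Fintype ι]

/-! ### Two addenda to the envelope API -/

/-- **The lower-corner envelope of any measurable density dominates it almost everywhere** (at every Lebesgue density
point of the rational superlevel sets through the point; a corner box is a `2^{-|ι|}`-th of the sup-norm ball).
[this work] -/
theorem ae_le_cornerEnvelope {g : (ι → ℝ) → ℝ≥0∞} (hg : Measurable g) :
    ∀ᵐ p ∂(volume : Measure (ι → ℝ)), g p ≤ cornerEnvelope g p := by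
  have hc2 : ∀ᵐ p ∂(volume : Measure (ι → ℝ)), ∀ t : ℚ, p ∈ {x | ENNReal.ofReal t < g x} →
      Tendsto (fun ρ => volume ({x | ENNReal.ofReal t < g x}ᶜ ∩ closedBall p ρ) / volume (closedBall p ρ))
        (𝓝[>] 0) (𝓝 0) := by
    rw [ae_all_iff]
    intro t
    have mS : MeasurableSet {x : ι → ℝ | ENNReal.ofReal (t : ℝ) < g x} := measurableSet_lt measurable_const hg
    filter_upwards [Besicovitch.ae_tendsto_measure_inter_div_of_measurableSet (volume : Measure (ι → ℝ)) mS.compl]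
      with p hp hpt
    have hn : p ∉ ({x : ι → ℝ | ENNReal.ofReal (t : ℝ) < g x})ᶜ := Set.notMem_compl_iff.2 hpt
    have h0 : ({x : ι → ℝ | ENNReal.ofReal (t : ℝ) < g x}ᶜ).indicator (1 : (ι → ℝ) → ℝ≥0∞) p = 0 :=
      Set.indicator_of_notMem hn _
    rwa [h0] at hp
  filter_upwards [hc2] with p hp2
  refine le_iInf fun n => le_of_forall_lt_imp_le_of_dense fun a ha => ?_
  obtain ⟨t, -, hat, htg⟩ := ENNReal.lt_iff_exists_rat_btwn.1 ha
  change a < ENNReal.ofReal t at hat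
  change ENNReal.ofReal t < g p at htg
  refine hat.le.trans ?_
  set S := {x : ι → ℝ | ENNReal.ofReal (t : ℝ) < g x} with hS
  have hd : Tendsto (fun m => volume (Sᶜ ∩ closedBall p (cornerRadius m)) / volume (closedBall p (cornerRadius m)))
      atTop (𝓝 0) := (hp2 t htg).comp tendsto_cornerRadius
  have hsmall : ∀ᶠ m in atTop, volume (Sᶜ ∩ closedBall p (cornerRadius m)) / volume (closedBall p (cornerRadius m)) <
      ((2 : ℝ≥0∞) ^ Fintype.card ι)⁻¹ :=
    (tendsto_order.1 hd).2 _ (ENNReal.inv_pos.2 (ENNReal.pow_ne_top ENNReal.ofNat_ne_top))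
  obtain ⟨m₀, hm₀⟩ := hsmall.exists_forall_of_atTop
  set m := max n m₀ with hm
  refine le_trans ?_ (cornerEssSup_antitone g p (le_max_left n m₀))
  by_contra hlt
  have hz : volume ({x | ENNReal.ofReal (t : ℝ) < g x} ∩
      Set.pi univ fun i => Ioc (p i - cornerRadius m) (p i)) = 0 :=
    measure_inter_eq_zero_of_essSup_restrict_le hg (not_le.1 hlt).le
  have hC : volume (Set.pi univ fun i => Ioc (p i - cornerRadius m) (p i)) =
      ENNReal.ofReal (cornerRadius m) ^ Fintype.card ι := volume_lowerCorner p (cornerRadius m)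
  have hBall : volume (closedBall p (cornerRadius m)) =
      2 ^ Fintype.card ι * ENNReal.ofReal (cornerRadius m) ^ Fintype.card ι :=
    volume_closedBall_eq_pow_mul p (cornerRadius_pos m).le
  have hR0 : ENNReal.ofReal (cornerRadius m) ^ Fintype.card ι ≠ 0 :=
    pow_ne_zero _ (ENNReal.ofReal_pos.2 (cornerRadius_pos m)).ne'
  have hRT : ENNReal.ofReal (cornerRadius m) ^ Fintype.card ι ≠ ∞ := ENNReal.pow_ne_top ENNReal.ofReal_ne_top
  have h2T : (2 : ℝ≥0∞) ^ Fintype.card ι ≠ ∞ := ENNReal.pow_ne_top ENNReal.ofNat_ne_top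
  have h20 : (2 : ℝ≥0∞) ^ Fintype.card ι ≠ 0 := pow_ne_zero _ two_ne_zero
  have hB0 : volume (closedBall p (cornerRadius m)) ≠ 0 := by rw [hBall]; exact mul_ne_zero h20 hR0
  have hBT : volume (closedBall p (cornerRadius m)) ≠ ∞ := by rw [hBall]; exact ENNReal.mul_ne_top h2T hRT
  have hlt' : volume (Sᶜ ∩ closedBall p (cornerRadius m)) <
      volume (Set.pi univ fun i => Ioc (p i - cornerRadius m) (p i)) := by
    have h1 := (ENNReal.div_lt_iff (Or.inl hB0) (Or.inl hBT)).1 (hm₀ m (le_max_right n m₀))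
    rw [hBall, ← mul_assoc, ENNReal.inv_mul_cancel h20 h2T, one_mul, ← hC] at h1
    exact h1
  have hsub : (Set.pi univ fun i => Ioc (p i - cornerRadius m) (p i)) ⊆
      ({x | ENNReal.ofReal (t : ℝ) < g x} ∩ Set.pi univ fun i => Ioc (p i - cornerRadius m) (p i)) ∪
        (Sᶜ ∩ closedBall p (cornerRadius m)) := by
    intro x hx
    by_cases hxS : x ∈ S
    · exact Or.inl ⟨hxS, hx⟩
    · exact Or.inr ⟨hxS, lowerCorner_subset_closedBall p (cornerRadius_pos m).le hx⟩
  have hle : volume (Set.pi univ fun i => Ioc (p i - cornerRadius m) (p i)) ≤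
      volume ({x | ENNReal.ofReal (t : ℝ) < g x} ∩ Set.pi univ fun i => Ioc (p i - cornerRadius m) (p i)) +
        volume (Sᶜ ∩ closedBall p (cornerRadius m)) :=
    (measure_mono hsub).trans (measure_union_le _ _)
  rw [hz, zero_add] at hle
  exact (lt_irrefl _) (hlt'.trans_le hle)

/-- **MTP₂ of the envelope at a pair with finite envelope at the four points involved** (the corner essential
suprema are MTP₂ at every pair, `cornerEssSup_mul_le`; pass to the limit). [this work] -/
theorem cornerEnvelope_mul_le_of_ne_top {g : (ι → ℝ) → ℝ≥0∞} (hg : Measurable g)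
    (hMTP : ∀ᵐ p ∂(volume : Measure (ι → ℝ)).prod volume, g p.1 * g p.2 ≤ g (p.1 ⊓ p.2) * g (p.1 ⊔ p.2))
    {x y : ι → ℝ} (hx : cornerEnvelope g x ≠ ∞) (hy : cornerEnvelope g y ≠ ∞)
    (hxy : cornerEnvelope g (x ⊓ y) ≠ ∞) (hxy' : cornerEnvelope g (x ⊔ y) ≠ ∞) :
    cornerEnvelope g x * cornerEnvelope g y ≤ cornerEnvelope g (x ⊓ y) * cornerEnvelope g (x ⊔ y) := by
  have hL : Tendsto (fun n => cornerEssSup g n x * cornerEssSup g n y) atTop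
      (𝓝 (cornerEnvelope g x * cornerEnvelope g y)) :=
    ENNReal.Tendsto.mul (tendsto_cornerEssSup g x) (Or.inr hy) (tendsto_cornerEssSup g y) (Or.inr hx)
  have hR : Tendsto (fun n => cornerEssSup g n (x ⊓ y) * cornerEssSup g n (x ⊔ y)) atTop
      (𝓝 (cornerEnvelope g (x ⊓ y) * cornerEnvelope g (x ⊔ y))) :=
    ENNReal.Tendsto.mul (tendsto_cornerEssSup g _) (Or.inr hxy') (tendsto_cornerEssSup g _) (Or.inr hxy)
  exact le_of_tendsto_of_tendsto' hL hR fun n => cornerEssSup_mul_le hg hMTP n x y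

/-- The envelope is bounded by an almost-everywhere bound on ONE corner box. [folklore] -/
theorem cornerEnvelope_le_of_ae_restrict_le {g : (ι → ℝ) → ℝ≥0∞} {M : ℝ≥0∞} {n : ℕ} {p : ι → ℝ}
    (h : ∀ᵐ z ∂(volume : Measure (ι → ℝ)).restrict (Set.pi univ fun i => Ioc (p i - cornerRadius n) (p i)),
      g z ≤ M) : cornerEnvelope g p ≤ M :=
  (cornerEnvelope_le_cornerEssSup g n p).trans (cornerEssSup_le_of_ae_restrict_le h)

/-- An almost-everywhere LOWER bound on a corner box bounds the corner essential supremum from below. [folklore] -/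
theorem le_cornerEssSup_of_ae_restrict_le {g : (ι → ℝ) → ℝ≥0∞} {δ : ℝ≥0∞} {n : ℕ} {p : ι → ℝ}
    (h : ∀ᵐ z ∂(volume : Measure (ι → ℝ)).restrict (Set.pi univ fun i => Ioc (p i - cornerRadius n) (p i)),
      δ ≤ g z) : δ ≤ cornerEssSup g n p := by
  calc δ = essSup (fun _ : ι → ℝ => δ)
        ((volume : Measure (ι → ℝ)).restrict (Set.pi univ fun i => Ioc (p i - cornerRadius n) (p i))) :=
        (essSup_const _ (volume_restrict_lowerCorner_ne_zero p n)).symm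
    _ ≤ cornerEssSup g n p := essSup_mono_ae h

omit [Fintype ι] in
/-- The corner boxes shrink: a later corner box lies in an earlier one. [folklore] -/
theorem lowerCorner_subset_lowerCorner (p : ι → ℝ) {m n : ℕ} (hmn : m ≤ n) :
    (Set.pi univ fun i => Ioc (p i - cornerRadius n) (p i)) ⊆ Set.pi univ fun i => Ioc (p i - cornerRadius m) (p i) :=
  fun _ hx => Set.mem_univ_pi.2 fun i =>
    ⟨lt_of_le_of_lt (sub_le_sub_left (cornerRadius_antitone hmn) _) (Set.mem_univ_pi.1 hx i).1,
      (Set.mem_univ_pi.1 hx i).2⟩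

/-- **A uniform almost-everywhere lower bound on the corner boxes from some index on bounds the envelope from
below.** [folklore] -/
theorem le_cornerEnvelope_of_ae_restrict_le {g : (ι → ℝ) → ℝ≥0∞} {δ : ℝ≥0∞} {n₀ : ℕ} {p : ι → ℝ}
    (h : ∀ᵐ z ∂(volume : Measure (ι → ℝ)).restrict (Set.pi univ fun i => Ioc (p i - cornerRadius n₀) (p i)),
      δ ≤ g z) : δ ≤ cornerEnvelope g p := by
  rw [cornerEnvelope_eq_iInf_ge g p n₀]
  refine le_iInf fun n => le_cornerEssSup_of_ae_restrict_le ?_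
  exact ae_restrict_of_ae_restrict_of_subset (lowerCorner_subset_lowerCorner p (Nat.le_add_left n₀ n)) h

/-- **The corner boxes at a point of an arm box eventually lie in the open orthant of the base point** (and below
the point). [folklore] -/
theorem eventually_lowerCorner_gt {c p : ι → ℝ} (hp : ∀ i, c i < p i) :
    ∀ᶠ n in atTop, ∀ x ∈ Set.pi univ (fun i => Ioc (p i - cornerRadius n) (p i)), ∀ i, c i < x i := by
  have h : ∀ i, ∀ᶠ n in atTop, cornerRadius n < p i - c i := fun i =>
    eventually_cornerRadius_lt (by linarith [hp i])
  filter_upwards [eventually_all.2 h] with n hn x hx i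
  have := (Set.mem_univ_pi.1 hx i).1
  linarith [hn i]


end Summit.CriticalPhenomena.PercolationContinuityZ3.Theorems.SahiAEFourFunctions
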